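import Literature.NumberTheory.Transcendental.Nesterenko2003Prop51Assembly
import Literature.NumberTheory.Transcendental.Nesterenko2003Prop51Degenerate
import Literature.NumberTheory.Transcendental.PhilipponZeroEstimateIsogeny
import HarnessLib

/-!
# Nesterenko 2003, Prop. 5.1 (= Waldschmidt 2000, Thm. 8.1): the discharge

Topic `Literature/NumberTheory/Transcendental`. This file DISCHARGES the named fact
`Literature.NumberTheory.Transcendental.Nesterenko2003_prop51` (`PhilipponZeroEstimateMultidegree.lean`):
Philippon's zero estimate on `G = 𝔾ₐ × 𝔾ₘⁿ ⊂ (ℙ¹)ⁿ⁺¹` with multiplicities `> (n+1)S₀` along a subspace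
`𝔚` at the points of `Σ[n+1]`, Laurent multidegrees `(D₀, D₁, …, Dₙ)`, and the explicit obstruction
polynomial `𝓗(G*; D₀, D₁, …, Dₙ) = d*!·2^{n−r}·D₀^{d₀}·∑_I |det M_I|·∏_{j∉I} D_j` (Nesterenko 2003,
LNM 1819, §5.1, (5.7) and Prop. 5.1; proof there = "[13, Theorem 8.1]", Waldschmidt, Grundlehren 326).

The proof assembles the cell's WP-M3.Z chain, all PROVED in the tree:
* (Z-a) the exact equal-degree zero estimate `GaGm.zero_estimate_exact_subgroup`
  (`PhilipponZeroEstimateChainExact`, `PhilipponZeroEstimateExact`: Roy's proof with the Bézout constant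
  `(n+1)!·D₀·Kⁿ` and the multiplicity of the obstructing subgroup kept symbolic);
* (Z-b) the general-rank lower bound for that multiplicity,
  `(dim H)!·D₀^{d₀}·K^{n−r}·∑_I |det M_I| ≤ mult_{D₀,K}(H)` (`GaGmSlices`, `GaGmSectionData`,
  `GaGmSectionComponents`, `GaGmSubgroupMultBound`, `GaGmTorsionCount`, `GaGmSliceMinors`);
* (Z-c) the isogeny `y_j ↦ y_j^{k_j}` reducing multidegrees to equal degrees
  (`GaGmIsogeny`, `GaGmIsogenyIndex`, `GaGmIsogenyLattice`, `PhilipponZeroEstimateIsogeny`: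
  `GaGm.zero_estimate_isogeny`);
* (Z-d) the arithmetic `GaGm.nesterenko2003_prop51_of_data` (`Nesterenko2003Prop51Assembly`) with
  `K = 2·D₁⋯Dₙ`, `k_j = ∏_{i≠j} D_i`, and the degenerate cases `D₀ = 0` / `D_j = 0`
  (`Nesterenko2003Prop51Degenerate`).

## References

* Yu. V. Nesterenko, *Linear forms in logarithms of rational numbers*, in: Diophantine Approximation
  (Cetraro 2000), LNM 1819, Springer 2003, 53–106: §5.1, Prop. 5.1, (5.7). [Nesterenko2003]
* M. Waldschmidt, *Diophantine Approximation on Linear Algebraic Groups*, Grundlehren 326 (2000),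
  Thm. 8.1. [Waldschmidt2000GL326]
* P. Philippon, *Lemmes de zéros dans les groupes algébriques commutatifs*, Bull. Soc. Math. France
  114 (1986), 355–383, Thm. 2.1 and §3. [Philippon1986]
-/

noncomputable section

open Module Finset

namespace Literature.NumberTheory.Transcendental

open GaGm

/-- **Nesterenko 2003, Prop. 5.1 / Waldschmidt 2000, Thm. 8.1 — PROVED.** Philippon's zero estimate
on `𝔾ₐ × 𝔾ₘⁿ ⊂ (ℙ¹)ⁿ⁺¹` with multiplicities and multidegrees and the explicit obstruction polynomial
(5.7), discharging the named fact `Nesterenko2003_prop51`.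
[cite: Nesterenko2003, Prop 5.1] [cite: Waldschmidt2000GL326, Thm 8.1] [cite: Philippon1986, Thm 2.1] -/
theorem Nesterenko2003_prop51_holds : Nesterenko2003_prop51 := by
  intro n D₀ S₀ D W S Q hS h1 hQ hdeg0 hdeg hvan
  classical
  -- degenerate torus degrees
  by_cases hD : ∃ j, D j = 0
  · exact nesterenko2003_prop51_of_D_eq_zero D₀ S₀ hD W S
  push Not at hD
  -- degenerate additive degree
  by_cases hD₀ : D₀ = 0
  · subst hD₀
    rcases Nat.eq_zero_or_pos n with hn | hn
    · subst hn
      exact (false_of_degreeOf_zero_of_vanishes hQ hdeg0 (by omega)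
        (hvan 1 (subset_sumset h1 le_rfl h1))).elim
    · exact nesterenko2003_prop51_of_D₀_eq_zero hn S₀ D W S
  -- the non-degenerate case: `K = 2·D₁⋯Dₙ`, `k_j = ∏_{i ≠ j} D_i`
  have hD₀' : 1 ≤ D₀ := Nat.pos_of_ne_zero hD₀
  have hDpos : ∀ j, 0 < D j := fun j => Nat.pos_of_ne_zero (hD j)
  set K : ℕ := 2 * ∏ j, D j with hKdef
  have hK : 1 ≤ K := by
    have : 0 < ∏ j, D j := Finset.prod_pos fun j _ => hDpos j
    omega
  let k : Fin n → ℕ := fun j => ∏ i ∈ Finset.univ.erase j, D i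
  have hk1 : ∀ j, 1 ≤ k j := fun j => Finset.prod_pos fun i _ => hDpos i
  have hkK : ∀ j, k j * (2 * D j) = K := by
    intro j
    change (∏ i ∈ Finset.univ.erase j, D i) * (2 * D j) = 2 * ∏ j, D j
    rw [← Finset.mul_prod_erase Finset.univ D (Finset.mem_univ j)]
    ring
  have hdeg' : ∀ j : Fin n, k j * Q.degreeOf j.succ ≤ K := fun j =>
    (Nat.mul_le_mul_left _ (hdeg j)).trans (hkK j).le
  obtain ⟨H', hirr', H, r, M, M', ι, ⟨c1, c1'⟩, ⟨c2, c2'⟩, ⟨c3, -⟩, c4, -, -, c6, c7⟩ :=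
    zero_estimate_isogeny (T := S₀) k hk1 W hD₀' hK hS h1 hQ hdeg0 hdeg' hvan
  exact nesterenko2003_prop51_of_data D₀ S₀ D hD₀' W S K hK k hkK H' hirr' H r M M' ι _
    c1 c1' c2 c2' c3 c4 rfl c6 c7

end Literature.NumberTheory.Transcendental
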